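/-
Copyright (c) 2026 the pub-hodgecm-mathlib formalisation cell (harness21).  Prover seat hodgecm-mathlib-K2Liu-p07 (g3), Track B «K2-LIT»,
#184♮ = hLiu418 = `stmt-HodgeConjecture-24832`; #42S payer road, organ (σ) (local value identity), K2Liu-p10 (g4)'s ASK 2 (2026-09-04 14:19Z): the Witt
(hyperbolic) frame of the ternary hermitian space OVER `L ⊗ L⁺_v` at a non-split place, in the `hP` shape of ★ `K2LiuKRFrameSliceLetter.slice_letter`.
-/
import Summits.HodgeConjecture.HodgeConjecture.Theorems.K2LiuHyperbolicFrameOfIsotropic   -- ★ (ii-gen) algebra: `exists_frame_conjTranspose_mul_eq_diagonal`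
import Summits.HodgeConjecture.HodgeConjecture.Theorems.K2LiuIsotropicVectorLocal        -- ★ (ii-gen) existence: `exists_isotropic_localRing`
import Summits.HodgeConjecture.HodgeConjecture.Theorems.K2LiuLocalRingInertReading        -- ★ K2Liu-p01: the reading at the unique place `w₀`
import HarnessLib

/-!
# Crux `HLiu418`, #42S organ (σ): A WITT FRAME `P ∈ GL₃(E ⊗ F_v)` WITH `Pᴴ · W₀ · P = diag(d)` AT A NON-SPLIT PLACE (`W₀ = [[0,1,0],[1,0,0],[0,0,−d₀d₁d₂]]`)

Cell `hodgecm-mathlib`, crux item hLiu418 = `stmt-HodgeConjecture-24832`; squad K2 ∕ K2Liu; LEAD F0P6-plan (g14), organ lead (σ) K2Liu-p09 (g6);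
prover K2Liu-p07 (g3).  THEOREMS ONLY (no `def`, no instance, no notation, no named-fact hypothesis, no `sorry`); lane
`--supports stmt-HodgeConjecture-24832 --as helper`.

WHY.  K2Liu-p10 (g4)'s slice letter (★ `K2LiuKRFrameSliceLetter.slice_letter`) for the Kudla–Rallis frame of the (σ) face takes BY VALUE a frame
`P : GL (Fin 3) (LocalRing E v)` with `(P.val.map (conjLocal E c v))ᵀ * W.map (toLocalRing E v) * P.val = (diagonal t).map (toLocalRing E v)`,
`W = !![0,1,0;1,0,0;0,0,d′]`.  This file supplies it at every NON-SPLIT `v` (`c • w₀ = w₀`) for `t k = ι_v(d k)` and `d′ = −t₀t₁t₂`: read `E ⊗ F_v` at the unique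
place `w₀` (★ K2Liu-p01 `K2LiuLocalRingInertReading`: evaluation is a bijective ring map carrying `conjLocal` to `σ_{w₀}`), take an isotropic vector there
(★ `exists_isotropic_localRing`), build the frame over the FIELD `E_{w₀}` (★ `exists_frame_conjTranspose_mul_eq_diagonal`), and read it back.
* **`exists_wittFrame_localRing`** — `∃ P : GL (Fin 3) (LocalRing E v)` with the displayed identity.
References: [Scharlau1985HermitianForms] Ch. 7 §6; [Omeara1963] §42, §63; [KudlaRallis1994] §1; [CasselsFrohlichANT1967] Ch. II §10.
HONEST LABEL.  Count-neutral helper: `HC_CM` is proved only modulo the 7 printed citations (2 remaining named inputs: hLiu418 = `stmt-HodgeConjecture-24832`,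
h413 = `stmt-HodgeConjecture-24833`) until rung 0 closes.
-/

set_option autoImplicit false
set_option linter.dupNamespace false -- the mandated namespace repeats `HodgeConjecture.HodgeConjecture`

noncomputable section

open scoped Matrix
open NumberField IsDedekindDomain Matrix
open Literature.NumberTheory.Automorphic Literature.NumberTheory.Automorphic.UnitaryGroup
open Summit.HodgeConjecture.HodgeConjecture.Cruxes.HLiu418.K2LiuHyperbolicFrameOfIsotropic
open Summit.HodgeConjecture.HodgeConjecture.Cruxes.HLiu418.K2LiuIsotropicVectorLocal
open Summit.HodgeConjecture.HodgeConjecture.Cruxes.HLiu418.K2LiuLocalRingInertReading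

namespace Summit.HodgeConjecture.HodgeConjecture.Cruxes.HLiu418.K2LiuWittFrameLocalRing

variable {F : Type} [Field F] [NumberField F] {E : Type} [Field E] [NumberField E] [Algebra F E] [Algebra.IsQuadraticExtension F E]
  (c : E ≃ₐ[F] E) (hc : c ≠ 1) {δ : E} (hcδ : c δ = -δ) (hδ : δ ≠ 0) {θ : F} (hθ : δ * δ = algebraMap F E θ)
  (v : HeightOneSpectrum (𝓞 F)) (w₀ : PlacesOver E v) (hw₀ : c • w₀.1 = w₀.1)

include hc hcδ hδ hθ hw₀ in
/-- **A WITT FRAME OVER `E ⊗ F_v` AT A NON-SPLIT PLACE**: for `d : Fin 3 → F_v` with all `d k ≠ 0` there is `P ∈ GL₃(E ⊗_F F_v)` with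
`(P^{c})ᵀ · ι(W₀) · P = ι(diag d)`, `W₀ = [[0,1,0],[1,0,0],[0,0,−d₀d₁d₂]]` — the by-value `hP` of ★ `slice_letter` (`t := d`, `d′ := −d₀d₁d₂`).
[cite: Scharlau1985HermitianForms, Ch. 7 §6] [cite: Omeara1963, §63] [cite: KudlaRallis1994, §1] -/
theorem exists_wittFrame_localRing (d : Fin 3 → v.adicCompletion F) (hd0 : ∀ k, d k ≠ 0) :
    ∃ P : GL (Fin 3) (LocalRing E v),
      (P.val.map (conjLocal E c v))ᵀ * ((!![0, 1, 0; 1, 0, 0; 0, 0, -(d 0 * d 1 * d 2)] : Matrix (Fin 3) (Fin 3) (v.adicCompletion F)).map (toLocalRing E v)) * P.val =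
        (Matrix.diagonal d).map (toLocalRing E v) := by
  -- the reading at `w₀`
  set ρ : LocalRing E v →+* w₀.1.adicCompletion E := Pi.evalRingHom (fun w : PlacesOver E v => w.1.adicCompletion E) w₀ with hρ
  have hρinj : Function.Injective ρ := inert_reading_injective c hc v w₀ hw₀
  have hρsurj : Function.Surjective ρ := inert_reading_surjective v w₀
  let τ : LocalRing E v ≃+* w₀.1.adicCompletion E := RingEquiv.ofBijective ρ ⟨hρinj, hρsurj⟩
  have hτ : ∀ z, τ z = ρ z := fun _ => rfl
  -- the local involution at `w₀`
  set σ : w₀.1.adicCompletion E →+* w₀.1.adicCompletion E := (galAdicCompletionMap c hw₀ : w₀.1.adicCompletion E →+* w₀.1.adicCompletion E) with hσ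
  have hσσ : ∀ x, σ (σ x) = x := fun x => galAdicCompletionMap_galAdicCompletionMap_of_smul_eq c w₀ hc hw₀ x
  have hρconj : ∀ z : LocalRing E v, ρ (conjLocal E c v z) = σ (ρ z) := fun z => conjLocal_apply_of_smul_eq c hc v w₀ hw₀ z
  -- the data over the field `E_{w₀}`
  set dK : Fin 3 → w₀.1.adicCompletion E := fun k => ρ (toLocalRing E v (d k)) with hdK
  have hdσ : ∀ k, σ (dK k) = dK k := fun k => by rw [hdK]; simp only; rw [← hρconj, conjLocal_toLocalRing]
  have hdK0 : ∀ k, dK k ≠ 0 := fun k h => hd0 k ((toLocalRing E v).injective (hρinj (by rw [map_zero, map_zero]; exact h)))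
  have ht₀ : (2 : w₀.1.adicCompletion E)⁻¹ + σ (2 : w₀.1.adicCompletion E)⁻¹ = 1 := by
    rw [map_inv₀, map_ofNat, ← two_mul, mul_inv_cancel₀ two_ne_zero]
  -- an isotropic vector, read at `w₀`
  obtain ⟨y, hy0, hyy⟩ := exists_isotropic_localRing c hcδ hδ hθ v d
  have hu0 : (fun k => ρ (y k)) ≠ 0 := by
    intro h
    apply hy0
    funext k
    exact hρinj (by rw [Pi.zero_apply, map_zero]; exact congrFun h k)
  have huu : (∑ k, dK k * ρ (y k) * σ (ρ (y k))) = 0 := by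
    have h := congrArg ρ hyy
    rw [map_sum, map_zero] at h
    simpa only [map_mul, hρconj] using h
  -- the frame over the field, and its reading back
  obtain ⟨Q, hQ1, hQ⟩ := exists_frame_conjTranspose_mul_eq_diagonal σ dK hσσ hdσ hdK0 ht₀ hu0 huu
  set P₀ : Matrix (Fin 3) (Fin 3) (LocalRing E v) := Q.map τ.symm with hP₀
  have hρP₀ : P₀.map ρ = Q := by
    rw [hP₀, Matrix.map_map]; conv_rhs => rw [← Matrix.map_id Q]
    exact congrArg _ (funext fun x => by simp [← hτ])
  clear_value P₀
  have hdet : P₀.det = 1 := hρinj (by rw [RingHom.map_det, RingHom.mapMatrix_apply, hρP₀, hQ1, map_one])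
  have hPu : IsUnit P₀ := (Matrix.isUnit_iff_isUnit_det P₀).2 (by rw [hdet]; exact isUnit_one)
  have h1 : P₀.map (⇑ρ ∘ ⇑(conjLocal E c v)) = Q.map σ := by
    rw [show (⇑ρ ∘ ⇑(conjLocal E c v)) = (⇑σ ∘ ⇑ρ) from funext hρconj, ← Matrix.map_map, hρP₀]
  have h1' : P₀ᵀ.map (⇑ρ ∘ ⇑(conjLocal E c v)) = (Q.map σ)ᵀ := by
    rw [← h1]; ext i j; rfl
  have h2 : ((!![0, 1, 0; 1, 0, 0; 0, 0, -(d 0 * d 1 * d 2)] : Matrix (Fin 3) (Fin 3) (v.adicCompletion F)).map (⇑ρ ∘ ⇑(toLocalRing E v))) =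
      ((!![0, 1, 0; 1, 0, 0; 0, 0, -(dK 0 * dK 1 * dK 2)] : Matrix (Fin 3) (Fin 3) (w₀.1.adicCompletion E))) := by
    ext i j
    fin_cases i <;> fin_cases j <;> simp [hdK, map_neg, map_mul]
  have h3 : (Matrix.diagonal d).map (⇑ρ ∘ ⇑(toLocalRing E v)) = Matrix.diagonal dK := by
    rw [Matrix.diagonal_map (by simp)]; rfl
  -- compare after reading at `w₀`
  have key : ((P₀.map (conjLocal E c v))ᵀ *
        ((!![0, 1, 0; 1, 0, 0; 0, 0, -(d 0 * d 1 * d 2)] : Matrix (Fin 3) (Fin 3) (v.adicCompletion F)).map (toLocalRing E v)) * P₀).map ρ =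
      ((Matrix.diagonal d).map (toLocalRing E v)).map ρ := by
    rw [Matrix.map_mul, Matrix.map_mul, ← Matrix.transpose_map, Matrix.map_map, Matrix.map_map, Matrix.map_map, hρP₀, h1', h2, h3, hQ]
  refine ⟨hPu.unit, ?_⟩
  rw [IsUnit.unit_spec]
  exact Matrix.map_injective hρinj key

end Summit.HodgeConjecture.HodgeConjecture.Cruxes.HLiu418.K2LiuWittFrameLocalRing
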